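import Summits.NavierStokesRegularity.NavierStokesRegularity.Theses.TerminalTrace
import Summits.NavierStokesRegularity.NavierStokesRegularity.Theorems.TerminalTraceTypeITraceScarL3StubLocalTypeIOfTypeIBlowup
import Summits.NavierStokesRegularity.NavierStokesRegularity.Theorems.TerminalTraceTypeITraceScarL3StubExtinctApexDOfL3Trace
import Summits.NavierStokesRegularity.NavierStokesRegularity.Theorems.TerminalTraceTypeITraceScarL3StubNoConfinedExtinctApex
import Literature.Analysis.FluidPDE.LiouvilleExcludesLocalTypeI
import HarnessLib

/-!
# Item `TerminalTrace.TypeITraceScarL3` (stmt-NavierStokesRegularity-18385): the item FOLLOWS BY NAME from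
# «no spread extinct Type-I apex» (line `apex-dichotomy` composed with its three landed stubs), and that
# remaining statement sits below the Liouville conjecture (L)

Seat ns-typeII-p3 g9 (cell ns-regularity-ideate), `--supports stmt-NavierStokesRegularity-18385` (helper;
the kernel record asked for by nsreg-p2 g27, ROUND-25 v5).  Everything here is CONDITIONAL on its displayed
hypothesis; nothing closes the item.

* `typeITraceScarL3_of_no_spreadExtinctApex` — the registered skeleton `apex-dichotomy`
  (`TypeITraceScarL3_of_stubs`, sha16 95aa062ef93d7802) with the `sorry`s of its three LANDED stubs replaced
  by the tree theorems `stub_localTypeI_of_typeIBlowup` (p576636), `stub_extinctApexD_of_L3trace` (p583907)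
  and `stub_no_confinedExtinctApex` (p585263): IF no SPREAD extinct Type-I apex is backward singular at the
  origin (the statement of the one open stub `stub_no_spreadExtinctApex`, Stub C — an ancient pair suitable
  in every `Q(a)` at the space–time origin, Albritton–Barker bound `𝐈(Q(a)) ≤ M` and plain pressure bound
  `D(z₀, r) ≤ D₀` at every scale, rate `‖U(s, y)‖ ≤ C/√(−s)`, weakly vanishing top trace, and NOT essentially
  bounded in any exterior backward slab), THEN `TypeITraceScarL3`.  Proof = the skeleton's: an `L³` ball at a
  backward-singular vertex of a Type-I-in-time first singularity produces an extinct apex with all six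
  clauses (Stub 2′ over Stub 1); a CONFINED one is excluded by Stub B; a spread one by the hypothesis.
* `not_isBackwardSingularPoint_apex_of_liouvilleConjectureNS` /
  `no_spreadExtinctApex_of_liouvilleConjectureNS` — the kernel record «Stub C ≤ (L)»: under the KNSS
  Liouville conjecture (`Summit.NavierStokesRegularity.NavierStokesRegularity.LiouvilleConjectureNS`, item
  stmt-NavierStokesRegularity-10661's definiens) an apex tuple cannot be backward singular at the origin,
  because its scale-one clauses (suitable in `Q(1)`, weak gradient on `Q(1)`, `𝐈(Q(1)) ≤ M < ∞`) together
  with backward singularity are LITERALLY a local Type-I singular point (`IsLocalTypeISingularPoint 1 0 U P`),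
  which (L) excludes (`not_localTypeISingularityExists_of_liouvilleConjectureNS`, Albritton–Barker 2019 §1
  via the blow-up to a mild bounded ancient solution).  The rate, the pressure bound, the top trace and the
  spread clause are not used — (L) kills every extinct apex, confined or spread.

WHAT THIS IS NOT: not NS regularity, not item 18385, not Stub C — by-name reductions; Stub C and (L) are
OPEN.  [folklore; KNSS2009 §6; AlbrittonBarker2019 §1 and §3; Seregin2014 §6.6]
-/

noncomputable section

set_option linter.dupNamespace false

namespace Summit.NavierStokesRegularity.NavierStokesRegularity.Theorems.TypeITraceScarL3

open MeasureTheory Set Function Filter Topology Metric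
open Literature.Analysis.FluidPDE
open scoped NNReal ENNReal InnerProductSpace RealInnerProductSpace

/-- **«No spread extinct Type-I apex» ⇒ `TypeITraceScarL3`** (line `apex-dichotomy` with its three landed
stubs).  If no SPREAD EXTINCT TYPE-I APEX is backward singular at the space–time origin — no pair `(U, P)`
suitable in every parabolic ball `Q(a)` at the origin with a weak gradient `G`, Albritton–Barker bound
`𝐈(Q(a)) ≤ M` and plain pressure bound `D(z₀, r) ≤ D₀` (`z₀.1 ≤ 0`) at every scale, rate
`‖U(s, y)‖ ≤ C/√(−s)` (a.e. `y`, every `s < 0`), weakly vanishing at the top time, and essentially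
unbounded in every exterior backward slab `(−δ, 0) × (closedBall 0 R)ᶜ` — then a Type-I-in-time first
singularity of a classical Leray–Hopf solution scars the terminal value out of `L³` near every
backward-singular point.  Proof: assume an `L³` ball; `stub_extinctApexD_of_L3trace` (fed with
`stub_localTypeI_of_typeIBlowup`) produces a backward-singular extinct apex; if it is essentially bounded in
some exterior backward slab, `stub_no_confinedExtinctApex` refutes it; otherwise the hypothesis does.
[folklore; Seregin2014 §6.6; AlbrittonBarker2019 §3] -/
theorem typeITraceScarL3_of_no_spreadExtinctApex
    (hC : ∀ (U : ℝ → EuclideanSpace ℝ (Fin 3) → EuclideanSpace ℝ (Fin 3))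
      (P : ℝ → EuclideanSpace ℝ (Fin 3) → ℝ)
      (G : ℝ → EuclideanSpace ℝ (Fin 3) →
        EuclideanSpace ℝ (Fin 3) →L[ℝ] EuclideanSpace ℝ (Fin 3))
      (M D₀ : ℝ≥0) (C : ℝ),
      (∀ a : ℝ, 0 < a →
        IsSuitableWeakSolutionInBall a (0 : ℝ × EuclideanSpace ℝ (Fin 3)) U P) →
      (∀ a : ℝ, 0 < a →
        HasWeakSpatialGradientOn
          (parabolicCylinderOpens a (0 : ℝ × EuclideanSpace ℝ (Fin 3))) U G) →
      (∀ a : ℝ, 0 < a →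
        typeIBound (parabolicCylinder a (0 : ℝ × EuclideanSpace ℝ (Fin 3))) U P G ≤ M) →
      (∀ z₀ : ℝ × EuclideanSpace ℝ (Fin 3), z₀.1 ≤ 0 →
        ∀ r : ℝ, 0 < r → cknD r z₀ P ≤ D₀) →
      (∀ s : ℝ, s < 0 →
        ∀ᵐ y : EuclideanSpace ℝ (Fin 3), ‖U s y‖ ≤ C / Real.sqrt (-s)) →
      (∀ φ : EuclideanSpace ℝ (Fin 3) → EuclideanSpace ℝ (Fin 3),
        ContDiff ℝ (⊤ : ℕ∞) φ →
        HasCompactSupport φ → ∀ ε : ℝ, 0 < ε →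
        ∃ s₀ : ℝ, s₀ < 0 ∧ ∀ᵐ s ∂(volume.restrict (Ioo s₀ 0)), |∫ y, ⟪U s y, φ y⟫| ≤ ε) →
      (∀ δ : ℝ, 0 < δ → ∀ R K : ℝ,
        ¬ (∀ᵐ z ∂(volume.restrict
          (Ioo (-δ) 0 ×ˢ (closedBall (0 : EuclideanSpace ℝ (Fin 3)) R)ᶜ)), ‖U z.1 z.2‖ ≤ K)) →
      ¬ IsBackwardSingularPoint U (0 : ℝ × EuclideanSpace ℝ (Fin 3))) :
    Summit.NavierStokesRegularity.NavierStokesRegularity.Theses.TerminalTrace.TypeITraceScarL3 := by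
  intro ν T hν hT u p hcl hLH _hdec hTI x₀ hsing ρ hρ hmem
  obtain ⟨U, P, G, M, D₀, C, hsw, hG, hI, hD, hrate, htop, hsingU⟩ :=
    stub_extinctApexD_of_L3trace ν T hν hT u p hcl hLH hTI x₀
      (TerminalTraceTypeITraceScarL3StubLocalTypeIOfTypeIBlowup.stub_localTypeI_of_typeIBlowup
        ν T hν hT u p hcl hLH hTI x₀)
      hsing ⟨ρ, hρ, hmem⟩
  by_cases hfar : ∃ δ : ℝ, 0 < δ ∧ ∃ R K : ℝ,
      ∀ᵐ z ∂(volume.restrict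
        (Ioo (-δ) 0 ×ˢ (closedBall (0 : EuclideanSpace ℝ (Fin 3)) R)ᶜ)), ‖U z.1 z.2‖ ≤ K
  · exact stub_no_confinedExtinctApex U P G M D₀ C hsw hG hI hD hrate htop hfar hsingU
  · exact hC U P G M D₀ C hsw hG hI hD hrate htop
      (fun δ hδ R K hbound => hfar ⟨δ, hδ, R, K, hbound⟩) hsingU

/-- **(L) excludes every backward-singular apex tuple** (the scale-one clauses suffice).  Under the KNSS
Liouville conjecture `LiouvilleConjectureNS`, a pair `(U, P)` that is a suitable weak solution in the unit
parabolic ball `Q(1)` at the space–time origin, with a weak spatial gradient `G` there and finite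
Albritton–Barker quantity `𝐈(Q(1)) ≤ M`, is NOT backward singular at the origin: otherwise
`(1, 0, U, P)` is literally a local Type-I singular point (`IsLocalTypeISingularPoint`), and (L) excludes
those (Albritton–Barker 2019, §1: the blow-up at such a point is a non-trivial mild bounded ancient
solution). [cite: AlbrittonBarker2019, §1 (paragraph after Thm 1.1)] -/
theorem not_isBackwardSingularPoint_apex_of_liouvilleConjectureNS
    (hL : Summit.NavierStokesRegularity.NavierStokesRegularity.LiouvilleConjectureNS)
    {U : ℝ → EuclideanSpace ℝ (Fin 3) → EuclideanSpace ℝ (Fin 3)}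
    {P : ℝ → EuclideanSpace ℝ (Fin 3) → ℝ}
    {G : ℝ → EuclideanSpace ℝ (Fin 3) → EuclideanSpace ℝ (Fin 3) →L[ℝ] EuclideanSpace ℝ (Fin 3)}
    {M : ℝ≥0}
    (hsw : IsSuitableWeakSolutionInBall 1 (0 : ℝ × EuclideanSpace ℝ (Fin 3)) U P)
    (hG : HasWeakSpatialGradientOn (parabolicCylinderOpens 1 (0 : ℝ × EuclideanSpace ℝ (Fin 3))) U G)
    (hI : typeIBound (parabolicCylinder 1 (0 : ℝ × EuclideanSpace ℝ (Fin 3))) U P G ≤ M) :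
    ¬ IsBackwardSingularPoint U (0 : ℝ × EuclideanSpace ℝ (Fin 3)) := fun hsing =>
  not_localTypeISingularityExists_of_liouvilleConjectureNS hL
    ⟨1, 0, U, P, one_pos, hsw, hsing, G, hG, lt_of_le_of_lt hI ENNReal.coe_lt_top⟩

/-- **Stub C sits below (L)**: the KNSS Liouville conjecture `LiouvilleConjectureNS` (item
stmt-NavierStokesRegularity-10661's definiens) IMPLIES the statement of the open stub
`stub_no_spreadExtinctApex` of line `apex-dichotomy` — indeed with the rate, the pressure bound, the top
trace and the spread clause unused: the scale-one clauses of the apex already make the origin a local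
Type-I singular point, excluded under (L) (`not_isBackwardSingularPoint_apex_of_liouvilleConjectureNS`).
Composed with `typeITraceScarL3_of_no_spreadExtinctApex` this re-derives `(L) ⇒ TypeITraceScarL3`
(cf. `typeITraceScarL3_of_typeIliouvilleL`). [cite: AlbrittonBarker2019, §1 (paragraph after Thm 1.1)] -/
theorem no_spreadExtinctApex_of_liouvilleConjectureNS
    (hL : Summit.NavierStokesRegularity.NavierStokesRegularity.LiouvilleConjectureNS) :
    ∀ (U : ℝ → EuclideanSpace ℝ (Fin 3) → EuclideanSpace ℝ (Fin 3))
      (P : ℝ → EuclideanSpace ℝ (Fin 3) → ℝ)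
      (G : ℝ → EuclideanSpace ℝ (Fin 3) →
        EuclideanSpace ℝ (Fin 3) →L[ℝ] EuclideanSpace ℝ (Fin 3))
      (M D₀ : ℝ≥0) (C : ℝ),
      (∀ a : ℝ, 0 < a →
        IsSuitableWeakSolutionInBall a (0 : ℝ × EuclideanSpace ℝ (Fin 3)) U P) →
      (∀ a : ℝ, 0 < a →
        HasWeakSpatialGradientOn
          (parabolicCylinderOpens a (0 : ℝ × EuclideanSpace ℝ (Fin 3))) U G) →
      (∀ a : ℝ, 0 < a →
        typeIBound (parabolicCylinder a (0 : ℝ × EuclideanSpace ℝ (Fin 3))) U P G ≤ M) →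
      (∀ z₀ : ℝ × EuclideanSpace ℝ (Fin 3), z₀.1 ≤ 0 →
        ∀ r : ℝ, 0 < r → cknD r z₀ P ≤ D₀) →
      (∀ s : ℝ, s < 0 →
        ∀ᵐ y : EuclideanSpace ℝ (Fin 3), ‖U s y‖ ≤ C / Real.sqrt (-s)) →
      (∀ φ : EuclideanSpace ℝ (Fin 3) → EuclideanSpace ℝ (Fin 3),
        ContDiff ℝ (⊤ : ℕ∞) φ →
        HasCompactSupport φ → ∀ ε : ℝ, 0 < ε →
        ∃ s₀ : ℝ, s₀ < 0 ∧ ∀ᵐ s ∂(volume.restrict (Ioo s₀ 0)), |∫ y, ⟪U s y, φ y⟫| ≤ ε) →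
      (∀ δ : ℝ, 0 < δ → ∀ R K : ℝ,
        ¬ (∀ᵐ z ∂(volume.restrict
          (Ioo (-δ) 0 ×ˢ (closedBall (0 : EuclideanSpace ℝ (Fin 3)) R)ᶜ)), ‖U z.1 z.2‖ ≤ K)) →
      ¬ IsBackwardSingularPoint U (0 : ℝ × EuclideanSpace ℝ (Fin 3)) :=
  fun _U _P _G _M _D₀ _C hsw hG hI _hD _hrate _htop _hspread =>
    not_isBackwardSingularPoint_apex_of_liouvilleConjectureNS hL (hsw 1 one_pos) (hG 1 one_pos)
      (hI 1 one_pos)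

/-- **(L) ⇒ `TypeITraceScarL3` through the apex dichotomy** (second derivation, cf.
`typeITraceScarL3_of_typeIliouvilleL`): compose `no_spreadExtinctApex_of_liouvilleConjectureNS` with
`typeITraceScarL3_of_no_spreadExtinctApex`. [folklore; KNSS2009 §6; AlbrittonBarker2019 §1] -/
theorem typeITraceScarL3_of_liouvilleConjectureNS
    (hL : Summit.NavierStokesRegularity.NavierStokesRegularity.LiouvilleConjectureNS) :
    Summit.NavierStokesRegularity.NavierStokesRegularity.Theses.TerminalTrace.TypeITraceScarL3 :=
  typeITraceScarL3_of_no_spreadExtinctApex (no_spreadExtinctApex_of_liouvilleConjectureNS hL)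

end Summit.NavierStokesRegularity.NavierStokesRegularity.Theorems.TypeITraceScarL3

end
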